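import Mathlib
import Summits.ValiantsHypothesis.ValiantsHypothesis.Theorems.ValuativeGCTValuativeFlipTernaryFormsBorderDeterminantal

/-!
# Pencil density criterion in `k` letters: a spanning certificate at ONE `k`-ary pencil makes
# every `k`-ary form of degree `m` border-determinantal

Crux `ValuativeGCT.ValuativeFlip` (stmt-ValiantsHypothesis-12624), wall-breaker axis D
("det-orbit-closure multiplicity bounds for detCensus", seat k3 gen 1 / 3).  The ternary chain of
seat k3-1 (`ValuativeGCTValuativeFlipPencilJacobian`, `…TernaryFormsBorderDeterminantal`) made
row 3 of the few-row table of `Det_m` equation-free through the Jacobian criterion at the cyclic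
ternary pencil.  This file is the same mechanism in an ARBITRARY number `k` of letters, packaged
as a reusable criterion whose only input is a finite spanning certificate:

* `pderiv_det_genPencilK`, `eval_pderiv_coeff_det_genPencilK` — Jacobi's formula for the generic
  `k`-ary pencil `Σ_t x_t a^{(t)}`: the Jacobian of the coefficient map
  `A ↦ (coeff_e det (Σ_t A^{(t)} x_t))_e` at `A` has columns the coefficient vectors of
  `x_t · adj(M_A)_{ji}`.
* `algebraicIndependent_coeff_det_pencil_of_certificate` — **THE CRITERION**: if at one pencil
  `M_A = Σ_t x_t A^{(t)}` of `m × m` scalar matrices every monomial of degree `m` in the `k`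
  letters lies in `span{x_t · adj(M_A)_{ji}}` (the image of the differential of `det` at `M_A`),
  then the coefficients of `det` of the GENERIC `k`-ary pencil are algebraically independent over
  any field of characteristic `0` — determinantal `k`-ary `m`-forms are Zariski dense.
* `aeval_mem_orbitClosure_detFormLex_of_certificate`,
  `mem_orbitClosure_detFormLex_of_vars_subset_range_of_certificate`,
  `topForms_mem_orbitClosure_detFormLex_of_certificate` — consequently EVERY form of degree `m`
  in any `k` letters of the matrix variables lies in `Δ(det_m)`; in particular hypothesis `H(k)`
  of `noFlip_of_topForms_mem_orbitClosure` (k14) holds at that `m`.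

By dimension (`k·m² ≥ C(m+k-1, k-1)` is necessary) a certificate can exist only for `k ≤ 3`
(all `m`: Dickson, landed), `k = 4, m ≤ 3` (quadric and cubic surfaces) and degenerate cases; the
companion file `…QuaternaryCubicsBorderDeterminantal` supplies the two quaternary certificates
and so completes the equation-free part of the few-letter table of `Det_m`.

References: L. E. Dickson, Trans. AMS 22 (1921) 167–179 (ternary forms; cubic surfaces §§8–9);
A. Beauville, *Determinantal hypersurfaces*, Michigan Math. J. 48 (2000) §4; R. Ehrenborg,
G.-C. Rota, Europ. J. Combin. 14 (1993) Thm 2.2 (Jacobian criterion); BLMW, SIAM J. Comput. 40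
(2011) §5.3 [folklore mechanism].
-/

-- `Summit.ValiantsHypothesis.ValiantsHypothesis.…` is the tree's mandated single-conjunct layout (Sub = Summit).
set_option linter.dupNamespace false

namespace Summit.ValiantsHypothesis.ValiantsHypothesis.Theorems.ValuativeFlip

open scoped BigOperators Matrix
open Finset

noncomputable section

/-! ## The generic `k`-ary pencil: Jacobi's formula and the Jacobian of the coefficient map -/

section Pencil

open MvPolynomial
open Literature.Computability.AlgebraicComplexity

variable {K : Type*} [Field K] {k m : ℕ}

/-- `genPK⟦K, k, m⟧`: the generic `k`-ary pencil `(Σ_t x_t · a^{(t)}_{ij})_{ij}` of `m × m`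
matrices, over `K[x_0, …, x_{k-1} ; a^{(t)}_{ij}]`. -/
local notation3 (prettyPrint := false) "genPK⟦" K ", " k ", " m "⟧" =>
  (Matrix.of fun i j : Fin m => ∑ t : Fin k,
    (MvPolynomial.X (Sum.inl t) : MvPolynomial (Fin k ⊕ (Fin k × Fin m × Fin m)) K) *
      MvPolynomial.X (Sum.inr (t, i, j)))

/-- Specialising the coefficients of the generic `k`-ary pencil at `A : Fin k × _ × _ → K` gives
the pencil `(Σ_t A^{(t)}_{ij} x_t)_{ij}` of `k`-ary linear forms. [folklore] -/
theorem genPencilK_map_aeval (A : Fin k × Fin m × Fin m → K) :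
    (genPK⟦K, k, m⟧).map ((aeval (Sum.elim X fun v => C (A v)) :
        MvPolynomial (Fin k ⊕ (Fin k × Fin m × Fin m)) K →ₐ[K] MvPolynomial (Fin k) K)) =
      Matrix.of fun i j : Fin m => ∑ t : Fin k, (X t : MvPolynomial (Fin k) K) * C (A (t, i, j)) := by
  refine Matrix.ext fun i j => ?_
  simp [Matrix.map_apply, Matrix.of_apply, map_sum, map_mul]

/-- **Evaluation of the coefficient polynomials** of the generic `k`-ary pencil determinant: at the
point `A`, `coeff_e (det genPK)` takes the value `coeff_e det (Σ_t A^{(t)} x_t)`. [folklore] -/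
theorem eval_coeff_det_genPencilK (A : Fin k × Fin m × Fin m → K) (e : Fin k →₀ ℕ) :
    eval A (coeff e (sumAlgEquiv K (Fin k) (Fin k × Fin m × Fin m) (genPK⟦K, k, m⟧).det)) =
      coeff e (Matrix.of fun i j : Fin m =>
        ∑ t : Fin k, (X t : MvPolynomial (Fin k) K) * C (A (t, i, j))).det := by
  rw [eval_coeff_sumAlgEquiv, AlgHom.map_det, ← genPencilK_map_aeval A]
  rfl

/-- **Jacobi's formula for the generic `k`-ary pencil.**
`∂/∂a^{(t)}_{ij} det (genPK) = x_t · adj(genPK)_{ji}`. [folklore] -/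
theorem pderiv_det_genPencilK (t : Fin k) (i j : Fin m) :
    pderiv (Sum.inr (t, i, j)) (genPK⟦K, k, m⟧).det =
      (X (Sum.inl t) : MvPolynomial (Fin k ⊕ (Fin k × Fin m × Fin m)) K) *
        (genPK⟦K, k, m⟧).adjugate j i := by
  classical
  rw [DeterminantalConormal.derivation_det_eq_trace_adjugate_mul]
  have hD : (genPK⟦K, k, m⟧).map (pderiv (Sum.inr (t, i, j)) :
      MvPolynomial (Fin k ⊕ (Fin k × Fin m × Fin m)) K →
        MvPolynomial (Fin k ⊕ (Fin k × Fin m × Fin m)) K) =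
      Matrix.of fun i' j' : Fin m => if i' = i ∧ j' = j then
        (X (Sum.inl t) : MvPolynomial (Fin k ⊕ (Fin k × Fin m × Fin m)) K) else 0 := by
    refine Matrix.ext fun i' j' => ?_
    simp only [Matrix.map_apply, Matrix.of_apply, map_sum, Derivation.leibniz, pderiv_X,
      smul_eq_mul]
    simp only [Pi.single_apply, Sum.inr.injEq, Prod.mk.injEq, reduceCtorEq, if_false, mul_zero,
      add_zero]
    by_cases h : i' = i ∧ j' = j
    · obtain ⟨rfl, rfl⟩ := h
      simp
    · rw [if_neg h]
      refine Finset.sum_eq_zero fun t' _ => ?_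
      rw [if_neg, mul_zero]
      tauto
  rw [hD, Matrix.trace]
  simp only [Matrix.diag_apply, Matrix.mul_apply, Matrix.of_apply, mul_ite, mul_zero]
  rw [Finset.sum_eq_single j]
  · rw [Finset.sum_eq_single i]
    · simp [mul_comm]
    · intro b _ hb
      rw [if_neg]
      exact fun h => hb h.1
    · intro h; exact absurd (Finset.mem_univ i) h
  · intro a _ ha
    refine Finset.sum_eq_zero fun b _ => ?_
    rw [if_neg]
    exact fun h => ha h.2
  · intro h; exact absurd (Finset.mem_univ j) h

/-- **The Jacobian of the coefficient map at a point** (`k` letters).  For the coefficient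
polynomials `G_e = coeff_e det (genPK)` and any point `A`,
`(∂ G_e / ∂ a^{(t)}_{ij})(A) = coeff_e (x_t · adj(M_A)_{ji})`, `M_A = Σ_t A^{(t)} x_t`. [folklore] -/
theorem eval_pderiv_coeff_det_genPencilK (A : Fin k × Fin m × Fin m → K)
    (v : Fin k × Fin m × Fin m) (e : Fin k →₀ ℕ) :
    eval A (pderiv v (coeff e
      (sumAlgEquiv K (Fin k) (Fin k × Fin m × Fin m) (genPK⟦K, k, m⟧).det))) =
      coeff e ((X v.1 : MvPolynomial (Fin k) K) * (Matrix.of fun i j : Fin m =>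
        ∑ t : Fin k, (X t : MvPolynomial (Fin k) K) * C (A (t, i, j))).adjugate v.2.2 v.2.1) := by
  classical
  obtain ⟨t, i, j⟩ := v
  rw [pderiv_coeff_sumAlgEquiv, eval_coeff_sumAlgEquiv, pderiv_det_genPencilK, map_mul, aeval_X,
    Sum.elim_inl, ← genPencilK_map_aeval A]
  congr 2
  have h := RingHom.map_adjugate ((aeval (Sum.elim X fun v => C (A v)) :
    MvPolynomial (Fin k ⊕ (Fin k × Fin m × Fin m)) K →ₐ[K] MvPolynomial (Fin k) K)).toRingHom
    (genPK⟦K, k, m⟧)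
  have h' := congrFun (congrFun h j) i
  rw [RingHom.mapMatrix_apply, Matrix.map_apply] at h'
  exact h'

/-- **Pencil density criterion (algebraic independence form).**  Let `A` be one `k`-ary pencil of
`m × m` scalar matrices, `M_A = Σ_t x_t A^{(t)}`.  If every monomial of degree `m` in
`x_0, …, x_{k-1}` lies in `span_K {x_t · adj(M_A)_{ji}}` — i.e. the differential of
`(B_t) ↦ det (Σ_t x_t B_t)` at `A` is onto the `k`-ary forms of degree `m` — then the coefficient
polynomials `coeff_e det (Σ_t x_t a^{(t)})` (`|e| = m`) of the GENERIC `k`-ary pencil are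
algebraically independent over `K` (characteristic `0`): no nonzero polynomial in the coefficients
of a `k`-ary form of degree `m` vanishes on all determinantal forms `det (Σ_t A^{(t)} x_t)`.
(Jacobian criterion `algebraicIndependent_of_jacobian_surjective` + Jacobi's formula.)
[folklore (Jacobian criterion, Ehrenborg–Rota 1993 Thm 2.2); Dickson 1921 for the instances] -/
theorem algebraicIndependent_coeff_det_pencil_of_certificate {K : Type*} [Field K] [CharZero K]
    (k m : ℕ) (A : Fin k × Fin m × Fin m → K)
    (hcert : ∀ e : Fin k →₀ ℕ, e.degree = m →
      (monomial e (1 : K)) ∈ Submodule.span K (Set.range fun v : Fin k × Fin m × Fin m =>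
        (X v.1 : MvPolynomial (Fin k) K) * (Matrix.of fun i j : Fin m =>
          ∑ t : Fin k, (X t : MvPolynomial (Fin k) K) * C (A (t, i, j))).adjugate v.2.2 v.2.1)) :
    AlgebraicIndependent K fun e : DegIdx (Fin k) m => MvPolynomial.coeff e.1
      (MvPolynomial.sumAlgEquiv K (Fin k) (Fin k × Fin m × Fin m)
        (Matrix.det (Matrix.of fun i j : Fin m => ∑ t : Fin k,
          (MvPolynomial.X (Sum.inl t) : MvPolynomial (Fin k ⊕ (Fin k × Fin m × Fin m)) K) *
            MvPolynomial.X (Sum.inr (t, i, j))))) := by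
  classical
  refine algebraicIndependent_of_jacobian_surjective _ A fun e => ?_
  obtain ⟨c, hc⟩ := (Submodule.mem_span_range_iff_exists_fun K).mp
    (hcert e.1 ((mem_degMonomials_iff).mp e.2))
  refine ⟨c, fun e' => ?_⟩
  simp only [eval_pderiv_coeff_det_genPencilK]
  have := congrArg (coeff e'.1) hc
  rw [coeff_sum, coeff_monomial] at this
  simp only [coeff_smul, smul_eq_mul] at this
  rw [this]
  by_cases h : e' = e
  · subst h; simp
  · rw [if_neg h, if_neg]
    exact fun h' => h (Subtype.ext h'.symm)

end Pencil

/-! ## From algebraic independence to the orbit closure: `k`-ary forms lie in `Δ(det_m)` -/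

section Density

open MvPolynomial
open Literature.NumberTheory.DiophantineGeometry Literature.Computability.AlgebraicComplexity

variable {k m : ℕ}

/-- The determinantal `k`-ary form `det (Σ_t A^{(t)} x_t)`, written in `k` letters `a t` of the
matrix, is a linear substitution of `det_m` (an element of `End · det_m`). [folklore] -/
theorem linSubst_detFormLex_eq_aeval_det_pencilK (a : Fin k → MatIdx m)
    (A : Fin k × Fin m × Fin m → ℂ) :
    linSubst (MatIdx m) ℂ (Matrix.of fun l p : MatIdx m =>
        ∑ t : Fin k, if l = a t then A (t, (ofLex p).1, (ofLex p).2) else 0) (detFormLex ℂ m) =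
      aeval (fun t => (X (a t) : MvPolynomial (MatIdx m) ℂ))
        (Matrix.of fun i j : Fin m =>
          ∑ t : Fin k, (X t : MvPolynomial (Fin k) ℂ) * C (A (t, i, j))).det := by
  classical
  rw [CutBites.Negative.detFormLex_eq_det_of, AlgHom.map_det, AlgHom.map_det]
  congr 1
  refine Matrix.ext fun i j => ?_
  simp only [AlgHom.mapMatrix_apply, Matrix.map_apply, Matrix.of_apply, linSubst_X, map_sum,
    map_mul, aeval_X, aeval_C, algebraMap_eq, ofLex_toLex, Finset.sum_smul, ite_smul, zero_smul]
  rw [Finset.sum_comm]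
  refine Finset.sum_congr rfl fun t _ => ?_
  rw [Finset.sum_ite_eq' Finset.univ (a t), if_pos (Finset.mem_univ _), smul_eq_C_mul, mul_comm]

/-- Determinantal `k`-ary forms are forms of degree `m`. [folklore] -/
theorem isHomogeneous_det_pencilK (A : Fin k × Fin m × Fin m → ℂ) :
    (Matrix.of fun i j : Fin m =>
      ∑ t : Fin k, (X t : MvPolynomial (Fin k) ℂ) * C (A (t, i, j))).det.IsHomogeneous m := by
  have h := Literature.AlgebraicGeometry.DeterminantalHypersurfaces.isHomogeneous_det_of_linear
    (X := Matrix.of fun i j : Fin m => ∑ t : Fin k, (X t : MvPolynomial (Fin k) ℂ) *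
      C (A (t, i, j))) fun i j => ?_
  · simpa using h
  · rw [Matrix.of_apply]
    refine IsHomogeneous.sum _ _ _ fun t _ => ?_
    simpa using (isHomogeneous_X ℂ t).mul (isHomogeneous_C (Fin k) (A (t, i, j)))

/-- The test polynomial `P` on `Sym^m ℂ^{m²}`, pulled back to `k`-ary coefficient vectors
`c ↦ Σ_e c_e x^e ↦ (its push-forward to the letters `ψ`)`, evaluates as `P` at that push-forward.
[folklore] -/
theorem eval_aeval_kCoeffPoly (ψ : Fin k → MvPolynomial (MatIdx m) ℂ)
    (P : MvPolynomial ((MatIdx m) →₀ ℕ) ℂ) (c : DegIdx (Fin k) m → ℂ) :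
    eval c (aeval (fun d : (MatIdx m) →₀ ℕ => ∑ e : DegIdx (Fin k) m,
        C (coeff d (aeval ψ (monomial e.1 (1 : ℂ)))) * X e) P) =
      aeval (coeffVec (aeval ψ (∑ e : DegIdx (Fin k) m, c e • monomial e.1 (1 : ℂ)))) P := by
  rw [eval_aeval_eq_aeval]
  have hfun : (fun d : (MatIdx m) →₀ ℕ => eval c (∑ e : DegIdx (Fin k) m,
      C (coeff d (aeval ψ (monomial e.1 (1 : ℂ)))) * X e)) =
      coeffVec (aeval ψ (∑ e : DegIdx (Fin k) m, c e • monomial e.1 (1 : ℂ))) := by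
    funext d
    rw [coeffVec_apply, map_sum, map_sum, coeff_sum]
    refine Finset.sum_congr rfl fun e _ => ?_
    rw [map_mul, eval_C, eval_X, smul_eq_C_mul, map_mul, aeval_C, algebraMap_eq, coeff_C_mul,
      mul_comm]
  rw [hfun]

/-- **Pencil density criterion (orbit-closure form): every `k`-ary form of degree `m` lies in
`Δ(det_m)`.**  Given a spanning certificate at one `k`-ary pencil of `m × m` matrices (hypothesis
of `algebraicIndependent_coeff_det_pencil_of_certificate`), for any `k` letters `a t` of the
matrix and any `k`-ary form `q` of degree `m`, `q(X_{a 0}, …, X_{a (k-1)}) ∈ Δ(det_m)`: a test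
polynomial vanishing on `GL · det_m` vanishes on `End · det_m`, hence at every determinantal
`k`-ary form in the letters `a`; as a polynomial in the `k`-ary coefficients it is killed by the
algebraically independent coefficient family, hence it is zero. [folklore, over Dickson 1921] -/
theorem aeval_mem_orbitClosure_detFormLex_of_certificate (A : Fin k × Fin m × Fin m → ℂ)
    (hcert : ∀ e : Fin k →₀ ℕ, e.degree = m →
      (monomial e (1 : ℂ)) ∈ Submodule.span ℂ (Set.range fun v : Fin k × Fin m × Fin m =>
        (X v.1 : MvPolynomial (Fin k) ℂ) * (Matrix.of fun i j : Fin m =>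
          ∑ t : Fin k, (X t : MvPolynomial (Fin k) ℂ) * C (A (t, i, j))).adjugate v.2.2 v.2.1))
    (a : Fin k → MatIdx m) (q : MvPolynomial (Fin k) ℂ) (hq : q.IsHomogeneous m) :
    aeval (fun t => (X (a t) : MvPolynomial (MatIdx m) ℂ)) q ∈
      orbitClosure (detFormLex ℂ m) := by
  classical
  rw [mem_orbitClosure_iff]
  intro P hP
  -- `P` vanishes on `End · det`
  have hEnd : ∀ B : Matrix (MatIdx m) (MatIdx m) ℂ,
      aeval (coeffVec (linSubst (MatIdx m) ℂ B (detFormLex ℂ m))) P = 0 := fun B =>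
    (mem_orbitClosure_iff.mp (endOrbit_subset_orbitClosure_holds _ ⟨B, rfl⟩)) P hP
  -- the test polynomial as a polynomial `Ψ` in the `k`-ary coefficients
  set Ψ : MvPolynomial (DegIdx (Fin k) m) ℂ := aeval (fun d : (MatIdx m) →₀ ℕ =>
    ∑ e : DegIdx (Fin k) m, C (coeff d (aeval (fun t => (X (a t) : MvPolynomial (MatIdx m) ℂ))
      (monomial e.1 (1 : ℂ)))) * X e) P with hΨ
  -- `Ψ` vanishes at the coefficient vector of every determinantal form ...
  have hD : ∀ A' : Fin k × Fin m × Fin m → ℂ,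
      eval (fun e : DegIdx (Fin k) m => coeff e.1 (Matrix.of fun i j : Fin m =>
        ∑ t : Fin k, (X t : MvPolynomial (Fin k) ℂ) * C (A' (t, i, j))).det) Ψ = 0 := by
    intro A'
    rw [hΨ, eval_aeval_kCoeffPoly,
      sum_coeff_smul_monomial_of_isHomogeneous (isHomogeneous_det_pencilK A'),
      ← linSubst_detFormLex_eq_aeval_det_pencilK a A']
    exact hEnd _
  -- ... i.e. at the values of the algebraically independent coefficient polynomials: `Ψ = 0`
  have hΨ0 : Ψ = 0 := by
    refine (algebraicIndependent_iff.mp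
      (algebraicIndependent_coeff_det_pencil_of_certificate (K := ℂ) k m A hcert))
      Ψ (MvPolynomial.funext fun A' => ?_)
    rw [map_zero, eval_aeval_eq_aeval]
    have hG : (fun e : DegIdx (Fin k) m => eval A' (coeff e.1 (sumAlgEquiv ℂ (Fin k)
        (Fin k × Fin m × Fin m) (Matrix.of fun i j : Fin m => ∑ t : Fin k,
          (X (Sum.inl t) : MvPolynomial (Fin k ⊕ (Fin k × Fin m × Fin m)) ℂ) *
            X (Sum.inr (t, i, j))).det))) =
        fun e : DegIdx (Fin k) m => coeff e.1 (Matrix.of fun i j : Fin m =>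
          ∑ t : Fin k, (X t : MvPolynomial (Fin k) ℂ) * C (A' (t, i, j))).det :=
      funext fun e => eval_coeff_det_genPencilK A' e.1
    rw [hG, MvPolynomial.aeval_eq_eval]
    exact hD A'
  -- conclusion: `P` vanishes at `q`, a point of `Sym^m ℂ^k`
  rw [← sum_coeff_smul_monomial_of_isHomogeneous hq, ← eval_aeval_kCoeffPoly, ← hΨ, hΨ0,
    map_zero]

/-- **Forms of degree `m` in `k` letters are border-determinantal, given a certificate.**  A
homogeneous polynomial of degree `m ≥ 1` in the matrix variables `MatIdx m` all of whose variables
are among `k` letters `a 0, …, a (k-1)` lies in `Δ(det_m)`. [folklore, over Dickson 1921] -/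
theorem mem_orbitClosure_detFormLex_of_vars_subset_range_of_certificate [NeZero m]
    (A : Fin k × Fin m × Fin m → ℂ)
    (hcert : ∀ e : Fin k →₀ ℕ, e.degree = m →
      (monomial e (1 : ℂ)) ∈ Submodule.span ℂ (Set.range fun v : Fin k × Fin m × Fin m =>
        (X v.1 : MvPolynomial (Fin k) ℂ) * (Matrix.of fun i j : Fin m =>
          ∑ t : Fin k, (X t : MvPolynomial (Fin k) ℂ) * C (A (t, i, j))).adjugate v.2.2 v.2.1))
    (a : Fin k → MatIdx m) {q : MvPolynomial (MatIdx m) ℂ} (hq : q.IsHomogeneous m)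
    (hvars : ↑q.vars ⊆ Set.range a) : q ∈ orbitClosure (detFormLex ℂ m) := by
  classical
  -- pull back to `k` variables
  let φ : MatIdx m → MvPolynomial (Fin k) ℂ := fun l =>
    if h : l ∈ Set.range a then X (Classical.choose h) else 0
  set q' : MvPolynomial (Fin k) ℂ := aeval φ q with hq'
  have hφ : ∀ l, (φ l).IsHomogeneous 1 := by
    intro l
    simp only [φ]
    split_ifs
    · exact isHomogeneous_X ℂ _
    · exact isHomogeneous_zero _ _ _
  have hq'hom : q'.IsHomogeneous m := by simpa only [one_mul] using hq.aeval φ hφ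
  have hback : aeval (fun t => (X (a t) : MvPolynomial (MatIdx m) ℂ)) q' = q := by
    rw [hq', ← AlgHom.comp_apply, comp_aeval]
    conv_rhs => rw [← aeval_X_left_apply (R := ℂ) q]
    refine hom_congr_vars (by ext; simp) (fun l hl _ => ?_) rfl
    have hl' : l ∈ Set.range a := hvars (Finset.mem_coe.mpr hl)
    simp only [AlgHom.toRingHom_eq_coe, RingHom.coe_coe, aeval_X, φ, dif_pos hl']
    rw [Classical.choose_spec hl']
  rw [← hback]
  exact aeval_mem_orbitClosure_detFormLex_of_certificate A hcert a q' hq'hom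

/-- **Hypothesis `H(k)` of `noFlip_of_topForms_mem_orbitClosure` from a certificate.** For `m ≥ 1`,
given a spanning certificate at one `k`-ary pencil of `m × m` matrices, every form of degree `m`
in the `k` greatest lexicographic letters of `MatIdx m` (the letters `i` with `m² ≤ idx(i) + k`)
lies in `Δ(det_m)`. [folklore, over Dickson 1921] -/
theorem topForms_mem_orbitClosure_detFormLex_of_certificate (m : ℕ) [NeZero m] {k : ℕ}
    (A : Fin k × Fin m × Fin m → ℂ)
    (hcert : ∀ e : Fin k →₀ ℕ, e.degree = m →
      (monomial e (1 : ℂ)) ∈ Submodule.span ℂ (Set.range fun v : Fin k × Fin m × Fin m =>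
        (X v.1 : MvPolynomial (Fin k) ℂ) * (Matrix.of fun i j : Fin m =>
          ∑ t : Fin k, (X t : MvPolynomial (Fin k) ℂ) * C (A (t, i, j))).adjugate v.2.2 v.2.1))
    (q : MvPolynomial (MatIdx m) ℂ) (hq : q.IsHomogeneous m)
    (hvars : ∀ i ∈ q.vars, m * m ≤ (((matIdxEquiv m).symm i : Fin (m * m)) : ℕ) + k) :
    q ∈ orbitClosure (detFormLex ℂ m) := by
  classical
  have hmm : 0 < m * m := Nat.mul_pos (NeZero.pos m) (NeZero.pos m)
  by_cases hk : k ≤ m * m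
  · let a : Fin k → MatIdx m := fun t => matIdxEquiv m ⟨m * m - 1 - t, by omega⟩
    refine mem_orbitClosure_detFormLex_of_vars_subset_range_of_certificate A hcert a hq
      fun i hi => ?_
    have h := hvars i (Finset.mem_coe.mp hi)
    refine ⟨⟨m * m - 1 - ((matIdxEquiv m).symm i : ℕ), by omega⟩, ?_⟩
    simp only [a]
    conv_rhs => rw [← (matIdxEquiv m).apply_symm_apply i]
    congr 1
    exact Fin.ext (by simp; omega)
  · -- more letters than variables: every letter is among the `a t`
    push Not at hk
    let a : Fin k → MatIdx m := fun t =>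
      if ht : (t : ℕ) < m * m then matIdxEquiv m ⟨t, ht⟩ else matIdxEquiv m ⟨0, hmm⟩
    refine mem_orbitClosure_detFormLex_of_vars_subset_range_of_certificate A hcert a hq
      fun i _ => ?_
    refine ⟨⟨((matIdxEquiv m).symm i : ℕ), lt_trans ((matIdxEquiv m).symm i).2 hk⟩, ?_⟩
    simp only [a, dif_pos ((matIdxEquiv m).symm i).2, Fin.eta, OrderIso.apply_symm_apply]

end Density

end

end Summit.ValiantsHypothesis.ValiantsHypothesis.Theorems.ValuativeFlip
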